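import Summits.ValiantsHypothesis.ValiantsHypothesis.Theorems.LacunarySymmetroidMatrixDescartesCensusDoorA34PlaneCompression

/-!
# `MatrixDescartes` census — three-letter pencils: the MONOTONE WINDOW below the top-letter threshold
# (positive semidefiniteness is inherited DOWNWARD in `t` as long as `ν (b − a) t^b ≤ a`)

HONEST FRAMING.  Object-search cell `pub-symmetroid`, route `LacunarySymmetroid`; beside the OPEN typed statement
`Theses.LacunarySymmetroid.DoorA34` (stmt-ValiantsHypothesis-19980, `= DoorA34 = PosRootLawAt 3 4 18`), asserted nowhere.  The cell's one named
mechanism for a hierarchical `(3,4)` nineteen is the `(5,2)` flag, which `…CensusDoorA34FlagLaw` closes past any middle-type root; what is left is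
the ALL-MIDDLE LAW for three-letter nine-rows («a `(3,3)` pencil with nine positive det-roots has a root of middle type»), equivalently (seat reports
DOOR-A34-P3G11 §3, DOOR-A34-P3G13 §2): for `G(t) = S₀ + t^a S₁ + t^b S₂` with `S₀ ≻ 0`, the walk `PD | gap | PD | … ` cannot have five gaps —
`λ_min G` cannot change sign nine times while `λ₂ G > 0`.  This file proves, for ALL sizes `n`, ALL real symmetric letters and all exponents
`0 < a < b`, the first rigorous piece of that count: a MONOTONE WINDOW.

* `threeLetter_cross_identity` — the algebra: `t₂^a • G(t₁) − t₁^a • G(t₂) = (t₂^a − t₁^a) • S₀ + (t₂^a t₁^b − t₁^a t₂^b) • S₂` (the middle letter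
  CANCELS).
* `window_scalar_le` — the real inequality behind the window: for `0 < t₁ < t₂`, `0 ≤ ν` and `ν (b − a) t₂^b ≤ a`:
  `ν · t₁^a t₂^a (t₂^{b−a} − t₁^{b−a}) ≤ t₂^a − t₁^a` (from `y^{k+1} − x^{k+1} ≤ (k+1) y^k (y − x)` and `(a+1) x^a (y − x) ≤ y^{a+1} − x^{a+1}`, both by
  induction — no calculus).
* **`posSemidef_cross_of_le_threshold`** — if `S₀ ⪰ 0` and `S₂ ⪯ ν S₀` (`ν ≥ 0`), then for `0 < t₁ < t₂` with `ν (b − a) t₂^b ≤ a` the matrix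
  `t₂^a • G(t₁) − t₁^a • G(t₂)` is positive semidefinite; hence **`posSemidef_of_posSemidef_later`**: `G(t₂) ⪰ 0 ⟹ G(t₁) ⪰ 0` — below the
  THRESHOLD `τ` (`ν (b − a) τ^b = a`) positive semidefiniteness is inherited downward in `t`, so `{t ≤ τ : G(t) ⪰ 0}` is an initial segment and
  the PSD walk has AT MOST ONE boundary crossing in `(0, τ]` (`no_two_psd_crossings_below_threshold`: `G(t₁) ⋡ 0`, `G(t₂) ⪰ 0`, `t₁ < t₂ ≤ τ` is
  impossible).  With `S₀ = I` and `ν = λ_max(S₂)₊` this is the statement «every dip of `λ_min` but the first starts after `t^b = a/((b−a)λ_max S₂)`»;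
  the mirror statement above the `S₁`-threshold (`S₁ ≺ 0`, `t^a ≥ b/((b−a)|λ_max S₁|)`) is the derivative form `d/dt (t^{−b} G) ⪰ 0` and is NOT
  typed here (its two-point form needs an integral).

READING (paper): all oscillation of an all-semidefinite walk is confined to the window between the two thresholds; the located maximum of
sign changes of `λ_min(I + t^aS₁ + t^bS₂)` is `6` (three diagonal dips; seat reports G11/G13), nine would be needed.  Nothing here bounds
`ζ_sym(3,4)`; `DoorA34` stays OPEN; nothing bears on `MatrixDescartes` (stmt-ValiantsHypothesis-18050) or on `VP ≠ VNP`.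
[folklore] Loewner-order bookkeeping (Mathlib `Matrix.PosSemidef.add/smul`) and two elementary power inequalities; no citation needed.
-/

-- `Summit.ValiantsHypothesis.ValiantsHypothesis.…` repeats a component by the D-0017 layout
-- (single-conjunct summit), which the `dupNamespace` linter flags; the name is mandated.
set_option linter.dupNamespace false

namespace Summit.ValiantsHypothesis.ValiantsHypothesis.Theorems.LacunarySymmetroidMatrixDescartes.Census

open scoped Matrix

/-! ## Two elementary power inequalities (no calculus) -/

/-- `y^(k+1) − x^(k+1) ≤ (k+1) · y^k · (y − x)` for `0 ≤ x ≤ y`. [folklore] -/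
theorem pow_sub_pow_le_mul (x y : ℝ) (hx : 0 ≤ x) (hxy : x ≤ y) (k : ℕ) :
    y ^ (k + 1) - x ^ (k + 1) ≤ (k + 1 : ℝ) * y ^ k * (y - x) := by
  induction k with
  | zero => simp
  | succ k ih =>
    have hy : 0 ≤ y := hx.trans hxy
    have hxk : x ^ (k + 1) ≤ y ^ (k + 1) := pow_le_pow_left₀ hx hxy _
    have hyk : 0 ≤ y ^ (k + 1) := pow_nonneg hy _
    -- y^{k+2} − x^{k+2} = y (y^{k+1} − x^{k+1}) + x^{k+1} (y − x)
    have hsplit : y ^ (k + 1 + 1) - x ^ (k + 1 + 1)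
        = y * (y ^ (k + 1) - x ^ (k + 1)) + x ^ (k + 1) * (y - x) := by ring
    rw [hsplit]
    have h1 : y * (y ^ (k + 1) - x ^ (k + 1)) ≤ y * ((k + 1 : ℝ) * y ^ k * (y - x)) :=
      mul_le_mul_of_nonneg_left ih hy
    have h2 : x ^ (k + 1) * (y - x) ≤ y ^ (k + 1) * (y - x) :=
      mul_le_mul_of_nonneg_right hxk (sub_nonneg.2 hxy)
    have h3 : y * ((k + 1 : ℝ) * y ^ k * (y - x)) + y ^ (k + 1) * (y - x)
        = ((k + 1 : ℕ) + 1 : ℝ) * y ^ (k + 1) * (y - x) := by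
      push_cast; ring
    linarith [h1, h2, h3]

/-- `(a+1) · x^a · (y − x) ≤ y^(a+1) − x^(a+1)` for `0 ≤ x ≤ y`. [folklore] -/
theorem mul_pow_le_pow_sub_pow (x y : ℝ) (hx : 0 ≤ x) (hxy : x ≤ y) (a : ℕ) :
    (a + 1 : ℝ) * x ^ a * (y - x) ≤ y ^ (a + 1) - x ^ (a + 1) := by
  induction a with
  | zero => simp
  | succ a ih =>
    have hy : 0 ≤ y := hx.trans hxy
    have hxa : 0 ≤ x ^ a := pow_nonneg hx _
    have hsplit : y ^ (a + 1 + 1) - x ^ (a + 1 + 1)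
        = y * (y ^ (a + 1) - x ^ (a + 1)) + x ^ (a + 1) * (y - x) := by ring
    rw [hsplit]
    -- y · (y^{a+1} − x^{a+1}) ≥ y · (a+1) x^a (y−x) ≥ x · (a+1) x^a (y − x)
    have h0 : 0 ≤ (a + 1 : ℝ) * x ^ a * (y - x) :=
      mul_nonneg (mul_nonneg (by positivity) hxa) (sub_nonneg.2 hxy)
    have h1 : x * ((a + 1 : ℝ) * x ^ a * (y - x)) ≤ y * (y ^ (a + 1) - x ^ (a + 1)) :=
      (mul_le_mul_of_nonneg_right hxy h0).trans (mul_le_mul_of_nonneg_left ih hy)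
    have h3 : ((a + 1 : ℕ) + 1 : ℝ) * x ^ (a + 1) * (y - x)
        = x * ((a + 1 : ℝ) * x ^ a * (y - x)) + x ^ (a + 1) * (y - x) := by
      push_cast; ring
    linarith [h1, h3]

/-- **The window inequality.**  For `0 < x < y`, `0 ≤ ν`, naturals `0 < a < b` and `ν · (b − a) · y^b ≤ a`:
`ν · x^a y^a (y^(b−a) − x^(b−a)) ≤ y^a − x^a`. [folklore] -/
theorem window_scalar_le {a b : ℕ} (ha : 0 < a) (hab : a < b) {x y ν : ℝ} (hx : 0 < x) (hxy : x < y) (hν : 0 ≤ ν)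
    (hthr : ν * ((b : ℝ) - a) * y ^ b ≤ a) :
    ν * (x ^ a * y ^ a * (y ^ (b - a) - x ^ (b - a))) ≤ y ^ a - x ^ a := by
  obtain ⟨a', rfl⟩ : ∃ a', a = a' + 1 := ⟨a - 1, by omega⟩
  obtain ⟨k, hk⟩ : ∃ k, b - (a' + 1) = k + 1 := ⟨b - (a' + 1) - 1, by omega⟩
  have hb : b = a' + 1 + (k + 1) := by omega
  rw [hk]
  have hy : 0 < y := hx.trans hxy
  have hxle : x ≤ y := hxy.le
  -- step 1: y^{k+1} − x^{k+1} ≤ (k+1) y^k (y − x)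
  have s1 := pow_sub_pow_le_mul x y hx.le hxle k
  -- step 2: (a'+1) x^{a'} (y − x) ≤ y^{a'+1} − x^{a'+1}
  have s2 := mul_pow_le_pow_sub_pow x y hx.le hxle a'
  -- the threshold in the form ν (k+1) x y^{a'+k+1} ≤ a'+1 (using x < y)
  have hba : ((b : ℝ) - (a' + 1 : ℕ)) = (k + 1 : ℝ) := by
    rw [hb]; push_cast; ring
  rw [hba, hb] at hthr
  have hthr' : ν * (k + 1 : ℝ) * (x * y ^ (a' + k + 1)) ≤ (a' + 1 : ℕ) := by
    have hxy' : x * y ^ (a' + k + 1) ≤ y ^ (a' + 1 + (k + 1)) := by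
      have : y ^ (a' + 1 + (k + 1)) = y * y ^ (a' + k + 1) := by ring
      rw [this]
      exact mul_le_mul_of_nonneg_right hxle (pow_nonneg hy.le _)
    have hνk : 0 ≤ ν * (k + 1 : ℝ) := mul_nonneg hν (by positivity)
    exact (mul_le_mul_of_nonneg_left hxy' hνk).trans hthr
  -- chain: ν x^{a'+1} y^{a'+1} (y^{k+1} − x^{k+1}) ≤ ν x^{a'+1} y^{a'+1} (k+1) y^k (y−x)
  --        = [ν (k+1) x y^{a'+k+1}] · x^{a'} (y − x) ≤ (a'+1) x^{a'} (y−x) ≤ y^{a'+1} − x^{a'+1}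
  have hpos : 0 ≤ ν * (x ^ (a' + 1) * y ^ (a' + 1)) :=
    mul_nonneg hν (mul_nonneg (pow_nonneg hx.le _) (pow_nonneg hy.le _))
  have c1 : ν * (x ^ (a' + 1) * y ^ (a' + 1) * (y ^ (k + 1) - x ^ (k + 1)))
      ≤ ν * (x ^ (a' + 1) * y ^ (a' + 1)) * ((k + 1 : ℝ) * y ^ k * (y - x)) := by
    have := mul_le_mul_of_nonneg_left s1 hpos
    simpa [mul_assoc] using this
  have c2 : ν * (x ^ (a' + 1) * y ^ (a' + 1)) * ((k + 1 : ℝ) * y ^ k * (y - x))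
      = (ν * (k + 1 : ℝ) * (x * y ^ (a' + k + 1))) * (x ^ a' * (y - x)) := by ring
  have hxa : 0 ≤ x ^ a' * (y - x) := mul_nonneg (pow_nonneg hx.le _) (sub_nonneg.2 hxle)
  have c3 : (ν * (k + 1 : ℝ) * (x * y ^ (a' + k + 1))) * (x ^ a' * (y - x)) ≤ (a' + 1 : ℕ) * (x ^ a' * (y - x)) :=
    mul_le_mul_of_nonneg_right hthr' hxa
  have c4 : ((a' + 1 : ℕ) : ℝ) * (x ^ a' * (y - x)) = (a' + 1 : ℝ) * x ^ a' * (y - x) := by push_cast; ring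
  calc ν * (x ^ (a' + 1) * y ^ (a' + 1) * (y ^ (k + 1) - x ^ (k + 1)))
      ≤ ν * (x ^ (a' + 1) * y ^ (a' + 1)) * ((k + 1 : ℝ) * y ^ k * (y - x)) := c1
    _ = (ν * (k + 1 : ℝ) * (x * y ^ (a' + k + 1))) * (x ^ a' * (y - x)) := c2
    _ ≤ (a' + 1 : ℕ) * (x ^ a' * (y - x)) := c3
    _ = (a' + 1 : ℝ) * x ^ a' * (y - x) := c4
    _ ≤ y ^ (a' + 1) - x ^ (a' + 1) := s2

/-! ## The cross identity: the middle letter cancels -/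

/-- **`t₂^a • G(t₁) − t₁^a • G(t₂) = (t₂^a − t₁^a) • S₀ + (t₂^a t₁^b − t₁^a t₂^b) • S₂`** for the three-letter pencil
`G(t) = S₀ + t^a • S₁ + t^b • S₂` (any size, any ring of scalars `ℝ`; the middle letter cancels). [folklore] -/
theorem threeLetter_cross_identity {n : Type*} [Fintype n] (S₀ S₁ S₂ : Matrix n n ℝ) (a b : ℕ) (t₁ t₂ : ℝ) :
    t₂ ^ a • (S₀ + t₁ ^ a • S₁ + t₁ ^ b • S₂) - t₁ ^ a • (S₀ + t₂ ^ a • S₁ + t₂ ^ b • S₂)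
      = (t₂ ^ a - t₁ ^ a) • S₀ + (t₂ ^ a * t₁ ^ b - t₁ ^ a * t₂ ^ b) • S₂ := by
  ext i j
  simp [Matrix.add_apply, Matrix.sub_apply, Matrix.smul_apply]
  ring

/-! ## Positive semidefiniteness is inherited downward below the threshold -/

/-- **MONOTONE WINDOW (two-point Loewner form).**  Let `S₀ ⪰ 0` and `ν • S₀ − S₂ ⪰ 0` with `ν ≥ 0` (e.g. `S₀ = 1`, `ν = λ_max(S₂)₊`),
`0 < a < b`, and `0 < t₁ < t₂` with `ν (b − a) t₂^b ≤ a`.  Then `t₂^a • G(t₁) − t₁^a • G(t₂) ⪰ 0`. [folklore] -/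
theorem posSemidef_cross_of_le_threshold {n : Type*} [Fintype n] [DecidableEq n] (S₀ S₁ S₂ : Matrix n n ℝ)
    {a b : ℕ} (ha : 0 < a) (hab : a < b) {ν : ℝ} (hν : 0 ≤ ν) (h0 : S₀.PosSemidef) (h2 : (ν • S₀ - S₂).PosSemidef)
    {t₁ t₂ : ℝ} (ht₁ : 0 < t₁) (h12 : t₁ < t₂) (hthr : ν * ((b : ℝ) - a) * t₂ ^ b ≤ a) :
    (t₂ ^ a • (S₀ + t₁ ^ a • S₁ + t₁ ^ b • S₂) - t₁ ^ a • (S₀ + t₂ ^ a • S₁ + t₂ ^ b • S₂)).PosSemidef := by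
  rw [threeLetter_cross_identity]
  -- c := t₁^a t₂^a (t₂^{b−a} − t₁^{b−a}) ≥ 0 and t₂^a t₁^b − t₁^a t₂^b = −c
  set c := t₁ ^ a * t₂ ^ a * (t₂ ^ (b - a) - t₁ ^ (b - a)) with hc
  have ht₂ : 0 < t₂ := ht₁.trans h12
  have hcnn : 0 ≤ c := by
    have : t₁ ^ (b - a) ≤ t₂ ^ (b - a) := pow_le_pow_left₀ ht₁.le h12.le _
    exact mul_nonneg (mul_nonneg (pow_nonneg ht₁.le _) (pow_nonneg ht₂.le _)) (sub_nonneg.2 this)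
  have hcoef : t₂ ^ a * t₁ ^ b - t₁ ^ a * t₂ ^ b = -c := by
    have eb : b = a + (b - a) := by omega
    rw [hc, eb, pow_add, pow_add]
    simp only [Nat.add_sub_cancel_left]
    ring
  rw [hcoef]
  -- scalar budget: ν c ≤ t₂^a − t₁^a
  have hwin : ν * c ≤ t₂ ^ a - t₁ ^ a := by
    rw [hc]; exact window_scalar_le ha hab ht₁ h12 hν hthr
  -- decomposition: (t₂^a − t₁^a) S₀ + (−c) S₂ = (t₂^a − t₁^a − ν c) • S₀ + c • (ν • S₀ − S₂)
  have hdec : (t₂ ^ a - t₁ ^ a) • S₀ + (-c) • S₂ = (t₂ ^ a - t₁ ^ a - ν * c) • S₀ + c • (ν • S₀ - S₂) := by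
    ext i j
    simp [Matrix.add_apply, Matrix.sub_apply, Matrix.smul_apply]
    ring
  rw [hdec]
  exact (h0.smul (sub_nonneg.2 hwin)).add (h2.smul hcnn)

/-- **Downward inheritance of positive semidefiniteness below the threshold**: under the hypotheses of
`posSemidef_cross_of_le_threshold`, `G(t₂) ⪰ 0 ⟹ G(t₁) ⪰ 0`. [folklore] -/
theorem posSemidef_of_posSemidef_later {n : Type*} [Fintype n] [DecidableEq n] (S₀ S₁ S₂ : Matrix n n ℝ)
    {a b : ℕ} (ha : 0 < a) (hab : a < b) {ν : ℝ} (hν : 0 ≤ ν) (h0 : S₀.PosSemidef) (h2 : (ν • S₀ - S₂).PosSemidef)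
    {t₁ t₂ : ℝ} (ht₁ : 0 < t₁) (h12 : t₁ < t₂) (hthr : ν * ((b : ℝ) - a) * t₂ ^ b ≤ a)
    (hG₂ : (S₀ + t₂ ^ a • S₁ + t₂ ^ b • S₂).PosSemidef) :
    (S₀ + t₁ ^ a • S₁ + t₁ ^ b • S₂).PosSemidef := by
  have hcross := posSemidef_cross_of_le_threshold S₀ S₁ S₂ ha hab hν h0 h2 ht₁ h12 hthr
  have ht₂a : 0 < t₂ ^ a := pow_pos (ht₁.trans h12) _
  -- t₂^a • G(t₁) = cross + t₁^a • G(t₂) ⪰ 0, then divide by t₂^a > 0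
  have hsum := hcross.add (hG₂.smul (pow_nonneg ht₁.le a))
  rw [sub_add_cancel] at hsum
  have := hsum.smul (inv_nonneg.2 ht₂a.le)
  rwa [smul_smul, inv_mul_cancel₀ ht₂a.ne', one_smul] at this

/-- **At most one PSD-boundary crossing below the threshold**: it is impossible that `G(t₁)` is NOT positive semidefinite while
`G(t₂)` is, for `0 < t₁ < t₂` with `ν (b − a) t₂^b ≤ a` (so on `(0, τ]`, `ν (b−a) τ^b = a`, the set of PSD times is an initial segment
and the walk `PD | gap | PD …` has at most one gap endpoint there). [folklore] -/
theorem no_two_psd_crossings_below_threshold {n : Type*} [Fintype n] [DecidableEq n] (S₀ S₁ S₂ : Matrix n n ℝ)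
    {a b : ℕ} (ha : 0 < a) (hab : a < b) {ν : ℝ} (hν : 0 ≤ ν) (h0 : S₀.PosSemidef) (h2 : (ν • S₀ - S₂).PosSemidef)
    {t₁ t₂ : ℝ} (ht₁ : 0 < t₁) (h12 : t₁ < t₂) (hthr : ν * ((b : ℝ) - a) * t₂ ^ b ≤ a)
    (hbad : ¬ (S₀ + t₁ ^ a • S₁ + t₁ ^ b • S₂).PosSemidef) (hgood : (S₀ + t₂ ^ a • S₁ + t₂ ^ b • S₂).PosSemidef) :
    False :=
  hbad (posSemidef_of_posSemidef_later S₀ S₁ S₂ ha hab hν h0 h2 ht₁ h12 hthr hgood)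

/-- The normalised case `S₀ = 1`, `S₂ ⪯ ν • 1`: below `t^b = a / ((b − a) ν)` a later PSD time forces all earlier times PSD. [folklore] -/
theorem posSemidef_of_posSemidef_later_one {n : Type*} [Fintype n] [DecidableEq n] (S₁ S₂ : Matrix n n ℝ)
    {a b : ℕ} (ha : 0 < a) (hab : a < b) {ν : ℝ} (hν : 0 ≤ ν) (h2 : (ν • (1 : Matrix n n ℝ) - S₂).PosSemidef)
    {t₁ t₂ : ℝ} (ht₁ : 0 < t₁) (h12 : t₁ < t₂) (hthr : ν * ((b : ℝ) - a) * t₂ ^ b ≤ a)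
    (hG₂ : ((1 : Matrix n n ℝ) + t₂ ^ a • S₁ + t₂ ^ b • S₂).PosSemidef) :
    ((1 : Matrix n n ℝ) + t₁ ^ a • S₁ + t₁ ^ b • S₂).PosSemidef :=
  posSemidef_of_posSemidef_later 1 S₁ S₂ ha hab hν Matrix.PosSemidef.one h2 ht₁ h12 hthr hG₂

/-! ## The mirror window: above the `S₁`-threshold positive semidefiniteness is inherited UPWARD

(Appended.)  For `S₀ ⪰ 0` and `−S₁ ⪰ π S₀` (`π ≥ 0`; e.g. `S₀ = 1`, `S₁ ≺ 0`, `π = |λ_max S₁|`), on `t^a ≥ b / ((b − a) π)` the matrix function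
`t^{−b} G(t)` is Loewner non-decreasing; the two-point form below needs no calculus either. -/

/-- **The mirror window inequality.**  For `0 < x < y`, naturals `0 < a`, `0 < k` and `π · k · x^a ≥ a + k` (so `π > 0`):
`y^(a+k) − x^(a+k) ≤ π · x^a y^a (y^k − x^k)`. [folklore] -/
theorem window_scalar_le' {a k : ℕ} (ha : 0 < a) (hk : 0 < k) {x y π : ℝ} (hx : 0 < x) (hxy : x < y)
    (hthr : (a : ℝ) + k ≤ π * k * x ^ a) :
    y ^ (a + k) - x ^ (a + k) ≤ π * (x ^ a * y ^ a * (y ^ k - x ^ k)) := by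
  obtain ⟨a', rfl⟩ : ∃ a', a = a' + 1 := ⟨a - 1, by omega⟩
  obtain ⟨k', rfl⟩ : ∃ k', k = k' + 1 := ⟨k - 1, by omega⟩
  have hy : 0 < y := hx.trans hxy
  have hxle : x ≤ y := hxy.le
  -- the two elementary bounds
  have s1 : y ^ (a' + 1) - x ^ (a' + 1) ≤ (a' + 1 : ℝ) * y ^ a' * (y - x) := pow_sub_pow_le_mul x y hx.le hxle a'
  have s2 : (k' + 1 : ℝ) * x ^ k' * (y - x) ≤ y ^ (k' + 1) - x ^ (k' + 1) := mul_pow_le_pow_sub_pow x y hx.le hxle k'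
  have hk0 : (0 : ℝ) < (k' + 1 : ℕ) := by positivity
  -- π x^a − 1 ≥ a/k
  have hπx : ((a' + 1 : ℕ) : ℝ) / (k' + 1 : ℕ) ≤ π * x ^ (a' + 1) - 1 := by
    rw [div_le_iff₀ hk0]
    have : ((a' + 1 : ℕ) : ℝ) + (k' + 1 : ℕ) ≤ π * (k' + 1 : ℕ) * x ^ (a' + 1) := hthr
    nlinarith [this]
  -- split: y^{a+k} − x^{a+k} = y^a (y^k − x^k) + x^k (y^a − x^a)
  have hsplit : y ^ (a' + 1 + (k' + 1)) - x ^ (a' + 1 + (k' + 1))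
      = y ^ (a' + 1) * (y ^ (k' + 1) - x ^ (k' + 1)) + x ^ (k' + 1) * (y ^ (a' + 1) - x ^ (a' + 1)) := by ring
  rw [hsplit]
  have hyk : 0 ≤ y ^ (k' + 1) - x ^ (k' + 1) := sub_nonneg.2 (pow_le_pow_left₀ hx.le hxle _)
  have hya : 0 ≤ y ^ (a' + 1) := pow_nonneg hy.le _
  have hxk : 0 ≤ x ^ (k' + 1) := pow_nonneg hx.le _
  -- (i) x^k (y^a − x^a) ≤ x^k · a y^{a'} (y − x) ≤ (a/k) y^a (y^k − x^k)
  have i1 : x ^ (k' + 1) * (y ^ (a' + 1) - x ^ (a' + 1)) ≤ x ^ (k' + 1) * ((a' + 1 : ℝ) * y ^ a' * (y - x)) :=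
    mul_le_mul_of_nonneg_left s1 hxk
  have i2 : x ^ (k' + 1) * ((a' + 1 : ℝ) * y ^ a' * (y - x)) ≤ y ^ (a' + 1) * (((a' + 1 : ℝ) / (k' + 1 : ℝ)) * ((k' + 1 : ℝ) * x ^ k' * (y - x))) := by
    -- both sides equal (a'+1)(y−x) · [x^{k'+1} y^{a'}] resp. [y^{a'+1} x^{k'}]; and x^{k'+1} y^{a'} ≤ y^{a'+1} x^{k'} since x ≤ y
    have hk1 : (k' + 1 : ℝ) ≠ 0 := by positivity
    have e : y ^ (a' + 1) * (((a' + 1 : ℝ) / (k' + 1 : ℝ)) * ((k' + 1 : ℝ) * x ^ k' * (y - x)))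
        = (a' + 1 : ℝ) * (y - x) * (y ^ (a' + 1) * x ^ k') := by
      field_simp
    have e' : x ^ (k' + 1) * ((a' + 1 : ℝ) * y ^ a' * (y - x)) = (a' + 1 : ℝ) * (y - x) * (x ^ (k' + 1) * y ^ a') := by ring
    rw [e, e']
    have hmono : x ^ (k' + 1) * y ^ a' ≤ y ^ (a' + 1) * x ^ k' := by
      have : y ^ (a' + 1) * x ^ k' - x ^ (k' + 1) * y ^ a' = x ^ k' * y ^ a' * (y - x) := by ring
      nlinarith [mul_nonneg (mul_nonneg (pow_nonneg hx.le k') (pow_nonneg hy.le a')) (sub_nonneg.2 hxle)]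
    exact mul_le_mul_of_nonneg_left hmono (mul_nonneg (by positivity) (sub_nonneg.2 hxle))
  have i3 : y ^ (a' + 1) * (((a' + 1 : ℝ) / (k' + 1 : ℝ)) * ((k' + 1 : ℝ) * x ^ k' * (y - x)))
      ≤ y ^ (a' + 1) * (((a' + 1 : ℝ) / (k' + 1 : ℝ)) * (y ^ (k' + 1) - x ^ (k' + 1))) :=
    mul_le_mul_of_nonneg_left (mul_le_mul_of_nonneg_left s2 (by positivity)) hya
  -- (ii) total ≤ (1 + a/k) y^a (y^k − x^k) ≤ π x^a · y^a (y^k − x^k)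
  have hak : ((a' + 1 : ℕ) : ℝ) / (k' + 1 : ℕ) = (a' + 1 : ℝ) / (k' + 1 : ℝ) := by push_cast; ring
  have i4 : (1 + (a' + 1 : ℝ) / (k' + 1 : ℝ)) * (y ^ (a' + 1) * (y ^ (k' + 1) - x ^ (k' + 1)))
      ≤ (π * x ^ (a' + 1)) * (y ^ (a' + 1) * (y ^ (k' + 1) - x ^ (k' + 1))) := by
    apply mul_le_mul_of_nonneg_right _ (mul_nonneg hya hyk)
    rw [← hak]; linarith [hπx]
  have e5 : (π * x ^ (a' + 1)) * (y ^ (a' + 1) * (y ^ (k' + 1) - x ^ (k' + 1)))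
      = π * (x ^ (a' + 1) * y ^ (a' + 1) * (y ^ (k' + 1) - x ^ (k' + 1))) := by ring
  calc y ^ (a' + 1) * (y ^ (k' + 1) - x ^ (k' + 1)) + x ^ (k' + 1) * (y ^ (a' + 1) - x ^ (a' + 1))
      ≤ y ^ (a' + 1) * (y ^ (k' + 1) - x ^ (k' + 1))
          + y ^ (a' + 1) * (((a' + 1 : ℝ) / (k' + 1 : ℝ)) * (y ^ (k' + 1) - x ^ (k' + 1))) := by linarith [i1, i2, i3]
    _ = (1 + (a' + 1 : ℝ) / (k' + 1 : ℝ)) * (y ^ (a' + 1) * (y ^ (k' + 1) - x ^ (k' + 1))) := by ring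
    _ ≤ (π * x ^ (a' + 1)) * (y ^ (a' + 1) * (y ^ (k' + 1) - x ^ (k' + 1))) := i4
    _ = π * (x ^ (a' + 1) * y ^ (a' + 1) * (y ^ (k' + 1) - x ^ (k' + 1))) := e5

/-- **Mirror cross identity**: `t₁^b • G(t₂) − t₂^b • G(t₁) = (t₁^b − t₂^b) • S₀ + (t₁^b t₂^a − t₂^b t₁^a) • S₁` (the top letter
cancels). [folklore] -/
theorem threeLetter_cross_identity' {n : Type*} [Fintype n] (S₀ S₁ S₂ : Matrix n n ℝ) (a b : ℕ) (t₁ t₂ : ℝ) :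
    t₁ ^ b • (S₀ + t₂ ^ a • S₁ + t₂ ^ b • S₂) - t₂ ^ b • (S₀ + t₁ ^ a • S₁ + t₁ ^ b • S₂)
      = (t₁ ^ b - t₂ ^ b) • S₀ + (t₁ ^ b * t₂ ^ a - t₂ ^ b * t₁ ^ a) • S₁ := by
  ext i j
  simp [Matrix.add_apply, Matrix.sub_apply, Matrix.smul_apply]
  ring

/-- **MIRROR MONOTONE WINDOW (two-point Loewner form).**  Let `S₀ ⪰ 0` and `−S₁ − π • S₀ ⪰ 0` with `π ≥ 0`, `0 < a < b`, and
`0 < t₁ < t₂` with `b ≤ π (b − a) t₁^a` (which forces `π > 0`).  Then `t₁^b • G(t₂) − t₂^b • G(t₁) ⪰ 0`. [folklore] -/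
theorem posSemidef_cross_of_ge_threshold {n : Type*} [Fintype n] [DecidableEq n] (S₀ S₁ S₂ : Matrix n n ℝ)
    {a b : ℕ} (ha : 0 < a) (hab : a < b) {π : ℝ} (h0 : S₀.PosSemidef) (h1 : (-S₁ - π • S₀).PosSemidef)
    {t₁ t₂ : ℝ} (ht₁ : 0 < t₁) (h12 : t₁ < t₂) (hthr : (b : ℝ) ≤ π * ((b : ℝ) - a) * t₁ ^ a) :
    (t₁ ^ b • (S₀ + t₂ ^ a • S₁ + t₂ ^ b • S₂) - t₂ ^ b • (S₀ + t₁ ^ a • S₁ + t₁ ^ b • S₂)).PosSemidef := by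
  rw [threeLetter_cross_identity']
  obtain ⟨k, hk⟩ : ∃ k, b = a + k := ⟨b - a, by omega⟩
  have hkpos : 0 < k := by omega
  set c := t₁ ^ a * t₂ ^ a * (t₂ ^ k - t₁ ^ k) with hc
  have ht₂ : 0 < t₂ := ht₁.trans h12
  have hcnn : 0 ≤ c := by
    have : t₁ ^ k ≤ t₂ ^ k := pow_le_pow_left₀ ht₁.le h12.le _
    exact mul_nonneg (mul_nonneg (pow_nonneg ht₁.le _) (pow_nonneg ht₂.le _)) (sub_nonneg.2 this)
  have hcoef : t₁ ^ b * t₂ ^ a - t₂ ^ b * t₁ ^ a = -c := by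
    rw [hc, hk, pow_add, pow_add]; ring
  rw [hcoef]
  -- scalar budget: t₂^b − t₁^b ≤ π c
  have hthr' : (a : ℝ) + k ≤ π * k * t₁ ^ a := by
    have e : ((b : ℝ) - a) = k := by rw [hk]; push_cast; ring
    have e2 : (b : ℝ) = a + k := by rw [hk]; push_cast; ring
    rw [e, e2] at hthr
    linarith [hthr]
  have hwin : t₂ ^ b - t₁ ^ b ≤ π * c := by
    rw [hc, hk]; exact window_scalar_le' ha hkpos ht₁ h12 hthr'
  -- decomposition: (t₁^b − t₂^b) S₀ + (−c) S₁ = c • (−S₁ − π S₀) + (π c − (t₂^b − t₁^b)) • S₀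
  have hdec : (t₁ ^ b - t₂ ^ b) • S₀ + (-c) • S₁ = c • (-S₁ - π • S₀) + (π * c - (t₂ ^ b - t₁ ^ b)) • S₀ := by
    ext i j
    simp [Matrix.add_apply, Matrix.sub_apply, Matrix.smul_apply, Matrix.neg_apply]
    ring
  rw [hdec]
  exact (h1.smul hcnn).add (h0.smul (sub_nonneg.2 hwin))

/-- **Upward inheritance of positive semidefiniteness above the `S₁`-threshold**: under the hypotheses of
`posSemidef_cross_of_ge_threshold`, `G(t₁) ⪰ 0 ⟹ G(t₂) ⪰ 0`. [folklore] -/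
theorem posSemidef_of_posSemidef_earlier {n : Type*} [Fintype n] [DecidableEq n] (S₀ S₁ S₂ : Matrix n n ℝ)
    {a b : ℕ} (ha : 0 < a) (hab : a < b) {π : ℝ} (h0 : S₀.PosSemidef) (h1 : (-S₁ - π • S₀).PosSemidef)
    {t₁ t₂ : ℝ} (ht₁ : 0 < t₁) (h12 : t₁ < t₂) (hthr : (b : ℝ) ≤ π * ((b : ℝ) - a) * t₁ ^ a)
    (hG₁ : (S₀ + t₁ ^ a • S₁ + t₁ ^ b • S₂).PosSemidef) :
    (S₀ + t₂ ^ a • S₁ + t₂ ^ b • S₂).PosSemidef := by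
  have hcross := posSemidef_cross_of_ge_threshold S₀ S₁ S₂ ha hab h0 h1 ht₁ h12 hthr
  have ht₁b : 0 < t₁ ^ b := pow_pos ht₁ _
  have hsum := hcross.add (hG₁.smul (pow_nonneg (ht₁.trans h12).le b))
  rw [sub_add_cancel] at hsum
  have := hsum.smul (inv_nonneg.2 ht₁b.le)
  rwa [smul_smul, inv_mul_cancel₀ ht₁b.ne', one_smul] at this

/-- **THE TWO WINDOWS TOGETHER.**  For `S₀ ⪰ 0`, `S₂ ⪯ ν S₀` (`ν ≥ 0`), `−S₁ ⪰ π S₀`, the PSD walk of `G(t) = S₀ + t^aS₁ + t^bS₂` has all its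
boundary crossings but at most two inside the window `a/((b−a)ν) < t^b`, `t^a < b/((b−a)π)`: below the lower threshold PSD-ness is inherited
downward, above the upper threshold upward.  Finite form: four times `0 < t₁ < t₂ ≤ τ` and `T ≤ t₃ < t₄` with `G(t₁) ⋡ 0 ⪯ G(t₂)` and
`G(t₃) ⪰ 0`, `G(t₄) ⋡ 0` are impossible. [folklore] -/
theorem no_psd_crossings_outside_window {n : Type*} [Fintype n] [DecidableEq n] (S₀ S₁ S₂ : Matrix n n ℝ)
    {a b : ℕ} (ha : 0 < a) (hab : a < b) {ν π : ℝ} (hν : 0 ≤ ν) (h0 : S₀.PosSemidef)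
    (h2 : (ν • S₀ - S₂).PosSemidef) (h1 : (-S₁ - π • S₀).PosSemidef) :
    (∀ t₁ t₂ : ℝ, 0 < t₁ → t₁ < t₂ → ν * ((b : ℝ) - a) * t₂ ^ b ≤ a →
        (S₀ + t₂ ^ a • S₁ + t₂ ^ b • S₂).PosSemidef → (S₀ + t₁ ^ a • S₁ + t₁ ^ b • S₂).PosSemidef) ∧
    (∀ t₃ t₄ : ℝ, 0 < t₃ → t₃ < t₄ → (b : ℝ) ≤ π * ((b : ℝ) - a) * t₃ ^ a →
        (S₀ + t₃ ^ a • S₁ + t₃ ^ b • S₂).PosSemidef → (S₀ + t₄ ^ a • S₁ + t₄ ^ b • S₂).PosSemidef) :=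
  ⟨fun _ _ ht₁ h12 hthr hG => posSemidef_of_posSemidef_later S₀ S₁ S₂ ha hab hν h0 h2 ht₁ h12 hthr hG,
   fun _ _ ht₃ h34 hthr hG => posSemidef_of_posSemidef_earlier S₀ S₁ S₂ ha hab h0 h1 ht₃ h34 hthr hG⟩

end Summit.ValiantsHypothesis.ValiantsHypothesis.Theorems.LacunarySymmetroidMatrixDescartes.Census
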